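/-
Copyright (c) 2026 the pub-hodgecm-mathlib formalisation cell (harness21).  Prover seat hodgecm-mathlib-LH6-p01 (g8): P6b wave C, row Dβ
(Dβ-thm HEAD) (desk F0P6b-plan (g14)); box LA-ref2 (g8) ∕ node LH10-p02 (g18), 2026-09-03.
-/
import Literature.AlgebraicGeometry.AbelianSchemes.LinearisationRigidDescent
import Literature.AlgebraicGeometry.AbelianSchemes.MumfordBundleKernelTranslationIso
import Literature.AlgebraicGeometry.AbelianSchemes.AbelianSchemeKOfLLocal
import Literature.AlgebraicGeometry.AbelianSchemes.RigidifyAlongUnitSlice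
import Literature.AlgebraicGeometry.GroupSchemes.TorsorSquareOfKernel
import HarnessLib

/-!
# The `K(L)`-linearisation of Mumford's bundle `Λ(L)` for the FINITE FLAT (scheme-theoretic) `K(L)` ([MumfordAV1970] §13, proof of the Theorem p. 125)

Layer `Literature/AlgebraicGeometry/AbelianSchemes`, namespace `Literature.AlgebraicGeometry.AbelianSchemes.AbelianSchemeOver`.  THEOREMS ONLY (no definition, no named
fact, no instance, no notation, no `sorry`).  Cell `pub/hodgecm-mathlib` (D-0151), P6b wave C, row Dβ (Dβ-thm HEAD) (desk F0P6b-plan (g14)); the `hDβ` input of the §D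
junction of `Cruxes/HLiu418/Lines/F0_P6b_MumfordDualFlat.lean` (`stub_L4B1uD_mumfordLambdaDescent`; lane `--supports stmt-HodgeConjecture-24832`); count-neutral.  HC_CM
is proved only modulo the printed citations (2 remaining named inputs hLiu418 = `stmt-HodgeConjecture-24832`, h413 = `stmt-HodgeConjecture-24833`) until rung 0 closes;
nothing here is about HC.

THE PRINT.  [MumfordAV1970] §13, proof of the Theorem p. 125: «Consider the sheaf `Λ(L)` on `X × X` … the action of `K(L)` on the second factor lifts to an action on
`Λ(L)`» (normalised along `{0} × X`), whence `Λ(L)` descends along `1 × π : X × X → X × X⁄K(L)` to the Poincaré sheaf.  The tree has the CONSTANT-group case (★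
`MumfordBundleEquivariantStructure`, finite `K ≤ K(L)(S)` of sections).  THIS FILE is the SCHEME-THEORETIC case needed in positive characteristic (`K(L)` finite flat,
possibly non-étale): `Z` any `S`-group scheme with a homomorphism `i : Z → A` lying in `K(L)` (★ `A.MemKOfL L i`), acting on the second factor of `A ×_S A` by the
kernel translation `(z, (x, y)) ↦ (x, i z · y)` (★ `GroupSchemes/TorsorSquareOfKernel.ModObj.ofKernelTranslation i A.X`, Dα).

* §1 `isModHom_unitSlice_kernelTranslation` — the slice `ε × 1 : A → A ×_S A` is a `Z`-morphism for the translation of `Z` on `A` through `i` (Mathlib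
  `Mod.scalarRestriction i` of `ModObj.regular`) and the kernel translation on `A ×_S A`;
* §2 **`nonempty_linearisation_mumfordBundle`** — `Λ(L)` CARRIES A `Z`-LINEARISATION (★ `Modules.Linearisation`) for the kernel translation, for `L` of rank one
  rigidified along the unit section and `i ∈ K(L)(Z)`, `A` over a locally Noetherian `S`: rigid descent along `{0} × A` (★ `exists_linearisation_restrictIso_eq`) of
  the canonical linearisation of `(ε × 1)^*Λ(L) ≅ 𝒪_A = (A → S)^*𝒪_S` (★ `Linearisation.ofPullback`), fed with ★ `nonempty_pullback_kernelTranslation_mumfordBundle_iso`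
  (some `σ^*Λ ≅ p₂^*Λ`, class calculus, no cube) and ★ `nonempty_pullback_unitSlice_mumfordBundle_iso` (`(ε × 1)^*Λ(L) ≅ 𝒪`);
  **`exists_linearisation_mumfordBundle_restrictIso_eq`** — the NORMALISED form: for every rigidification `e` of `Λ(L)` along `ε × 1` there is a linearisation restricting
  along the slice to the trivial linearisation transported by `e` (unique by ★ `linearisation_iso_eq_of_restrictIso_eq`).

## References
* [MumfordAV1970] D. Mumford, *Abelian Varieties* (1970), §13 (Thm. p. 125 and its proof pp. 125–127); §8 (pp. 78–80).
* [MumfordFogartyKirwan1994] D. Mumford, J. Fogarty, F. Kirwan, *GIT* 3rd ed. (1994), Ch. 1 §3 Def. 1.6 (p. 30).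
* [MilneAV2008] J. S. Milne, *Abelian Varieties* (v2.00, 2008), I §8 (p. 40).
-/

set_option autoImplicit false

noncomputable section

-- `Scheme.Modules` / `SheafOfModules` are not reducible; `(A.X ⊗ A.X).left = pullback A.X.hom A.X.hom` holds by `rfl` only.
set_option backward.isDefEq.respectTransparency false

universe u

open CategoryTheory CategoryTheory.Limits AlgebraicGeometry MonoidalCategory CartesianMonoidalCategory
open scoped MonObj

namespace Literature.AlgebraicGeometry.AbelianSchemes

open Literature.AlgebraicGeometry.Modules Literature.AlgebraicGeometry.Motives Literature.AlgebraicGeometry.AbelianVarieties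
  Literature.AlgebraicGeometry.RelativeSpec Literature.AlgebraicGeometry.GroupSchemes

namespace AbelianSchemeOver

section MumfordLinearisation

variable {S : Scheme.{u}} (A : AbelianSchemeOver S) {Z : Over S} [GrpObj Z] (i : Z ⟶ A.X) [IsMonHom i]

/-- **The slice `ε × 1 : A → A ×_S A` is a `Z`-MORPHISM** for the translation action of `Z` on `A` through the homomorphism `i` (Mathlib `Mod.scalarRestriction i`
of the regular action) and the kernel translation on the second factor of `A ×_S A` (★ `TorsorSquareOfKernel.ModObj.ofKernelTranslation i A.X`): on points
`(z, y) ↦ (0, i z · y)` both ways. [cite: MumfordAV1970, §13 (p. 125)] -/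
theorem isModHom_unitSlice_kernelTranslation :
    letI : ModObj A.X A.X := ModObj.regular A.X
    letI : ModObj Z A.X := Mod.scalarRestriction i A.X
    letI : ModObj Z (A.X ⊗ A.X) := TorsorSquareOfKernel.ModObj.ofKernelTranslation i A.X
    IsModHom Z ((λ_ A.X).inv ≫ η[A.X] ▷ A.X) := by
  letI : ModObj A.X A.X := ModObj.regular A.X
  letI : ModObj Z A.X := Mod.scalarRestriction i A.X
  letI : ModObj Z (A.X ⊗ A.X) := TorsorSquareOfKernel.ModObj.ofKernelTranslation i A.X
  refine ⟨?_⟩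
  change ((i ▷ A.X) ≫ μ[A.X]) ≫ ((λ_ A.X).inv ≫ η[A.X] ▷ A.X) =
    (Z ◁ ((λ_ A.X).inv ≫ η[A.X] ▷ A.X)) ≫
      lift (snd Z (A.X ⊗ A.X) ≫ fst A.X A.X) (lift (fst Z (A.X ⊗ A.X)) (snd Z (A.X ⊗ A.X) ≫ snd A.X A.X) ≫ (i ▷ A.X) ≫ μ[A.X])
  have h1 : (λ_ A.X).inv ≫ snd (𝟙_ (Over S)) A.X = 𝟙 _ := by rw [← leftUnitor_hom, Iso.inv_hom_id]
  apply CartesianMonoidalCategory.hom_ext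
  · simp only [Category.assoc, lift_fst, whiskerRight_fst, leftUnitor_inv_fst_assoc, whiskerLeft_snd_assoc, comp_toUnit_assoc]
  · simp only [Category.assoc, lift_snd, whiskerRight_snd, h1, Category.comp_id, comp_lift_assoc, whiskerLeft_fst,
      whiskerLeft_snd_assoc]
    rw [lift_fst_snd, Category.id_comp]

variable [IsLocallyNoetherian S] [IsCommMonObj A.X]

/-- **THE `K(L)`-LINEARISATION OF MUMFORD'S BUNDLE `Λ(L)`, SCHEME-THEORETIC** ([MumfordAV1970] §13, proof of the Theorem p. 125: «the action of `K(L)` on the second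
factor of `X × X` lifts to `Λ(L)`», for the finite flat — possibly non-étale — `K(L)`): for an abelian scheme `A` over a locally Noetherian `S`, an `S`-group scheme `Z`
with a homomorphism `i : Z → A` lying in `K(L)` (`A.MemKOfL L i`), and `L` of rank one rigidified along the unit section, Mumford's bundle `Λ(L)` carries a
`Z`-LINEARISATION (★ `Modules.Linearisation`) for the kernel translation `(z, (x, y)) ↦ (x, i z · y)` (★ `TorsorSquareOfKernel.ModObj.ofKernelTranslation i A.X`).
Road: rigid descent along `{0} × A` (★ `exists_linearisation_restrictIso_eq`) of the canonical linearisation of `(ε × 1)^*Λ(L) ≅ 𝒪_A = (A → S)^*𝒪_S` (★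
`Linearisation.ofPullback`), the inputs being ★ `nonempty_pullback_kernelTranslation_mumfordBundle_iso` (some `σ^*Λ ≅ p₂^*Λ`, class calculus) and ★
`nonempty_pullback_unitSlice_mumfordBundle_iso` (`(ε × 1)^*Λ(L) ≅ 𝒪`).  The `hDβ` input of the §D junction of `Lines/F0_P6b_MumfordDualFlat.lean`.
[cite: MumfordAV1970, §13 Theorem (p. 125) and its proof (pp. 125–127)] [cite: MumfordFogartyKirwan1994, Ch. 1 §3 Def. 1.6 (p. 30)] -/
theorem nonempty_linearisation_mumfordBundle {L : A.left.Modules} (hL : HasRank L 1)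
    (hε : CechPic.pullback A.unitSection (detClass (HasRank.isFiniteLocallyFree' hL)) = 1) (hZL : A.MemKOfL L i) :
    Nonempty (Linearisation Z (A.X ⊗ A.X) (σ := TorsorSquareOfKernel.ModObj.ofKernelTranslation i A.X) (A.mumfordBundle L)) := by
  letI : ModObj A.X A.X := ModObj.regular A.X
  letI : ModObj Z A.X := Mod.scalarRestriction i A.X
  letI : ModObj Z (A.X ⊗ A.X) := TorsorSquareOfKernel.ModObj.ofKernelTranslation i A.X
  haveI : IsModHom Z ((λ_ A.X).inv ≫ η[A.X] ▷ A.X) := A.isModHom_unitSlice_kernelTranslation i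
  -- (E): some `σ^*Λ ≅ p₂^*Λ`
  have hex : Nonempty ((Scheme.Modules.pullback (γ[Z, A.X ⊗ A.X]).left).obj (A.mumfordBundle L) ≅
      (Scheme.Modules.pullback (snd Z (A.X ⊗ A.X)).left).obj (A.mumfordBundle L)) :=
    A.nonempty_pullback_kernelTranslation_mumfordBundle_iso i hL hZL
  -- `(ε × 1)^*Λ(L) ≅ 𝒪_A`
  obtain ⟨e₀⟩ := A.nonempty_pullback_unitSlice_mumfordBundle_iso hL hε
  have heq : ((λ_ A.X).inv ≫ η[A.X] ▷ A.X).left = A.unitSlice A :=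
    (A.unitSection_baseChange_eq_whiskerRight_left A.X).symm.trans (unitSection_baseChange_eq_unitSlice A A)
  let e : (Scheme.Modules.pullback ((λ_ A.X).inv ≫ η[A.X] ▷ A.X).left).obj (A.mumfordBundle L) ≅ SheafOfModules.unit _ :=
    (Scheme.Modules.pullbackCongr heq).app _ ≪≫ e₀
  -- the canonical linearisation of `(ε × 1)^*Λ(L) ≅ (A → S)^*𝒪_S`, and rigid descent
  obtain ⟨Φ, -⟩ := A.exists_linearisation_restrictIso_eq A.X (A.hasRank_mumfordBundle hL) hex e
    ((Linearisation.ofPullback Z A.X (SheafOfModules.unit _)).ofIso (RigidifiedLineBundle.pullbackUnitIso A.X.hom ≪≫ e.symm))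
  exact ⟨Φ⟩

/-- **THE NORMALISED LINEARISATION** ([MumfordAV1970] §13 p. 125: normalised along `{0} × X`): for every rigidification `e : (ε × 1)^*Λ(L) ≅ 𝒪_A` there is a
`Z`-linearisation of `Λ(L)` for the kernel translation whose restriction along the slice `ε × 1` (★ `Modules.restrictIso`) is the structure isomorphism of the TRIVIAL
linearisation of `𝒪_A = (A → S)^*𝒪_S` transported by `e` (★ `Linearisation.ofPullback`, `.ofIso`); it is unique (★ `linearisation_iso_eq_of_restrictIso_eq`).
[cite: MumfordAV1970, §13 Theorem (p. 125) and its proof (pp. 125–127)] [cite: MumfordFogartyKirwan1994, Ch. 1 §3 Def. 1.6 (p. 30)] -/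
theorem exists_linearisation_mumfordBundle_restrictIso_eq {L : A.left.Modules} (hL : HasRank L 1) (hZL : A.MemKOfL L i)
    (e : (Scheme.Modules.pullback ((λ_ A.X).inv ≫ η[A.X] ▷ A.X).left).obj (A.mumfordBundle L) ≅ SheafOfModules.unit _) :
    letI : ModObj A.X A.X := ModObj.regular A.X
    letI : ModObj Z A.X := Mod.scalarRestriction i A.X
    letI : ModObj Z (A.X ⊗ A.X) := TorsorSquareOfKernel.ModObj.ofKernelTranslation i A.X
    haveI : IsModHom Z ((λ_ A.X).inv ≫ η[A.X] ▷ A.X) := A.isModHom_unitSlice_kernelTranslation i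
    ∃ Φ : Linearisation Z (A.X ⊗ A.X) (A.mumfordBundle L),
      Modules.restrictIso ((λ_ A.X).inv ≫ η[A.X] ▷ A.X) (A.mumfordBundle L) Φ.iso =
        ((Linearisation.ofPullback Z A.X (SheafOfModules.unit _)).ofIso (RigidifiedLineBundle.pullbackUnitIso A.X.hom ≪≫ e.symm)).iso := by
  letI : ModObj A.X A.X := ModObj.regular A.X
  letI : ModObj Z A.X := Mod.scalarRestriction i A.X
  letI : ModObj Z (A.X ⊗ A.X) := TorsorSquareOfKernel.ModObj.ofKernelTranslation i A.X
  haveI : IsModHom Z ((λ_ A.X).inv ≫ η[A.X] ▷ A.X) := A.isModHom_unitSlice_kernelTranslation i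
  have hex : Nonempty ((Scheme.Modules.pullback (γ[Z, A.X ⊗ A.X]).left).obj (A.mumfordBundle L) ≅
      (Scheme.Modules.pullback (snd Z (A.X ⊗ A.X)).left).obj (A.mumfordBundle L)) :=
    A.nonempty_pullback_kernelTranslation_mumfordBundle_iso i hL hZL
  exact A.exists_linearisation_restrictIso_eq A.X (A.hasRank_mumfordBundle hL) hex e _

end MumfordLinearisation

end AbelianSchemeOver

end Literature.AlgebraicGeometry.AbelianSchemes

end
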